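import Literature.AlgebraicGeometry.Surfaces.K3LatticeInvariantsProofs
import Literature.Geometry.Kaehler.HolomorphicSymplecticFraming
import HarnessLib

/-!
# The intersection form of a K3 surface is even — discharge of `K3_even_intersectionForm`

Family `hodge`, layer `Literature/AlgebraicGeometry/Surfaces`. Theorems-only companion (D-0026: no
definition, no named fact) of `K3LatticeInvariants.lean`, closing its named fact
`Literature.AlgebraicGeometry.Surfaces.K3_even_intersectionForm`:
`theorem K3_even_intersectionForm_holds : K3_even_intersectionForm`.

**The printed proof** (Huybrechts, *Lectures on K3 Surfaces*, Ch. 1, proof of Prop. 3.5, p. 24):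
"the intersection pairing is even, since `c₁(X) = 0` implies `w₂(X) = 0`, and `(α.α) ≡ (w₂.α) (2)`"
(Milnor–Stasheff: Wu's formula Thm. 11.14, `w₂ ≡ c₁ (2)` Problem 14-B). The tree has no
Stiefel–Whitney classes, so the middle step is replaced by an explicit geometric substitute with
the same endpoints, assembled from PROVED tree results:

1. (`K3LatticeInvariantsProofs.lean`, `K3_even_intersectionForm_of_hodgeModel`) the fact follows
   from `x ∪ x = 0` for all `x ∈ H²(X^an; ℤ/2)` on a Hodge model `X^an` of `S` (mod-`2` reduction,
   `⟨a ∪ a, [S]⟩ ≡ ⟨ā ∪ ā, [S]₂⟩`, transport along `X^an ≅ S(ℂ)`);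
2. (`Geometry/Kaehler/HolomorphicSymplecticFraming.lean`,
   `exists_finite_hasTangentFramingAlong_compl_recharted`) `c₁ = 0` made explicit: the
   nowhere-vanishing holomorphic `2`-form `η` of `IsK3Surface` (`K_X ≅ 𝒪`) and a Morse function
   with a gradient-like vector field FRAME the tangent bundle of `X^an` off the finitely many
   critical points (`s, is, ξ, iξ` with `Re η(s, ·) = df`);
3. (`Topology/FourManifolds/FramedOffFiniteSetEven.lean`,
   `cupProduct_self_eq_zero_of_hasTangentFramingAlong_compl_finite`) a closed connected smooth
   `4`-manifold framed off a finite set has `x ∪ x = Sq² x = 0` on `H²(−; ℤ/2)` (Kervaire–Milnor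
   1963 §7 / Kosinski X (3.1): move the finite set into a ball, the complement of the open ball is
   a parallelizable null-cobordism of `S³`, and `Sq` into the top degree vanishes).

* `IsK3Surface.exists_hodgeModel_hasTangentFramingAlong_compl_finite` — step 2 for a K3 surface;
* `IsK3Surface.exists_hodgeModel_cupProduct_self_eq_zero` — steps 2 + 3;
* `K3_even_intersectionForm_holds` — the discharge.

## References

* [Huybrechts2016K3] D. Huybrechts, *Lectures on K3 Surfaces* (CUP 2016), Ch. 1 Def. 1.1,
  Prop. 3.5 and its proof (p. 24).
* [MilnorStasheff1974] J. Milnor, J. Stasheff, *Characteristic Classes* (1974), §2, Thm. 11.14,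
  Problem 14-B.
* [KervaireMilnorAnnals1963] M. Kervaire, J. Milnor, *Groups of homotopy spheres I*, Ann. of
  Math. 77 (1963), §7.
-/

noncomputable section

open scoped Manifold ContDiff Topology
open Literature.AlgebraicTopology.SingularHomology
open Literature.Topology.FourManifolds
open Literature.Geometry.Kaehler

namespace Literature.AlgebraicGeometry.Surfaces

variable {S : Motives.SchemeOver ℂ}

/-- **The Hodge model of a K3 surface, re-charted on `ℝ⁴`, is framed off a finite set**: the
holomorphic symplectic form `η` of `IsK3Surface` is holomorphic in charts and nowhere zero on the
compact complex surface `X^an`, so `exists_finite_hasTangentFramingAlong_compl_recharted` applies.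
[cite: Huybrechts2016K3, Ch. 1 Def. 1.1 and §3.3 p. 24] -/
theorem IsK3Surface.exists_hodgeModel_hasTangentFramingAlong_compl_finite (hS : IsK3Surface S) :
    ∃ (A : HodgeTheory.HodgeModel 2 S) (L : A.model ≃L[ℝ] EuclideanSpace ℝ (Fin 4))
      (F : Set (Recharted A.carrier L)), F.Finite ∧
        HasTangentFramingAlong (𝓡 4) (Recharted A.carrier L)
          ((↑) : (Fᶜ : Set (Recharted A.carrier L)) → Recharted A.carrier L) := by
  obtain ⟨A, η, hη, hη0⟩ := hS.2.2
  haveI : CompactSpace A.carrier := A.compactSpace_carrier hS.1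
  haveI : SecondCountableTopology A.carrier :=
    ChartedSpace.secondCountable_of_sigmaCompact A.model A.carrier
  have hfin : Module.finrank ℂ A.model = 2 := A.isAnalytification.finrank_eq
  have hfinℝ : Module.finrank ℝ A.model = 4 := by rw [finrank_real_of_complex, hfin]
  let L : A.model ≃L[ℝ] EuclideanSpace ℝ (Fin 4) :=
    ContinuousLinearEquiv.ofFinrankEq (by rw [hfinℝ, finrank_euclideanSpace_fin])
  obtain ⟨F, hF, hfr⟩ := exists_finite_hasTangentFramingAlong_compl_recharted hfin hη hη0 L
  exact ⟨A, L, F, hF, hfr⟩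

/-- **Cup squares vanish on `H²(X^an; ℤ/2)` for the Hodge model of a K3 surface** (the statement
"`w₂(X) = 0`" of Huybrechts p. 24 in the form `x ∪ x = v₂ ∪ x = 0`): the re-charted `X^an` is a
closed connected smooth `4`-manifold framed off a finite set, so
`cupProduct_self_eq_zero_of_hasTangentFramingAlong_compl_finite` (Kervaire–Milnor) applies; the
re-charting does not change the underlying topological space. [cite: Huybrechts2016K3, Ch. 1 Prop. 3.5, proof (p. 24)]
[cite: KervaireMilnorAnnals1963, §7, footnote pp. 528–529] -/
theorem IsK3Surface.exists_hodgeModel_cupProduct_self_eq_zero (hS : IsK3Surface S) :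
    ∃ A : HodgeTheory.HodgeModel 2 S,
      ∀ x : singularCohomology (ZMod 2) (ZMod 2) A.carrier (2 * 1),
        cupProduct (rfl : 2 * 1 + 2 * 1 = 2 * 2) x x = 0 := by
  obtain ⟨A, L, F, hF, hfr⟩ := hS.exists_hodgeModel_hasTangentFramingAlong_compl_finite
  refine ⟨A, fun x => ?_⟩
  have hX := hS.isSmoothProjective
  letI := hX.chartedSpace
  haveI := Motives.ComplexPoints.compactSpace_of_isSmoothProjective hX
  haveI := Motives.ComplexPoints.t2Space_of_isSmoothProjective hX
  haveI := HodgeTheory.connectedSpace_complexPoints hX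
  have hφ := A.isAnalytification
  haveI : CompactSpace A.carrier := A.compactSpace_carrier hX
  haveI : ConnectedSpace A.carrier :=
    hφ.homeomorph.symm.surjective.connectedSpace hφ.homeomorph.symm.continuous
  haveI : SecondCountableTopology A.carrier :=
    ChartedSpace.secondCountable_of_sigmaCompact A.model A.carrier
  haveI : CompactSpace (Recharted A.carrier L) := ‹CompactSpace A.carrier›
  exact cupProduct_self_eq_zero_of_hasTangentFramingAlong_compl_finite (n := 3)
    (X := Recharted A.carrier L) (by norm_num) (p := 2) rfl hF hfr x

/-- **The intersection form of a K3 surface is even** — discharge of the named fact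
`Literature.AlgebraicGeometry.Surfaces.K3_even_intersectionForm` (Huybrechts, Ch. 1 Prop. 3.5,
proof p. 24: "even since `c₁ = 0` implies `w₂ = 0`"), through
`K3_even_intersectionForm_of_hodgeModel` and `IsK3Surface.exists_hodgeModel_cupProduct_self_eq_zero`.
[cite: Huybrechts2016K3, Ch. 1 Prop. 3.5, proof (p. 24)] [cite: MilnorStasheff1974, Thm. 11.14 and Problem 14-B] -/
theorem K3_even_intersectionForm_holds : K3_even_intersectionForm :=
  K3_even_intersectionForm_of_hodgeModel fun _ hS => hS.exists_hodgeModel_cupProduct_self_eq_zero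

end Literature.AlgebraicGeometry.Surfaces

end
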